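import Literature.NumberTheory.GaloisRepresentations.IdeleClassBarBoundaryIdeleLayer
import Literature.NumberTheory.GaloisRepresentations.IdeleClassInvariant
import Literature.NumberTheory.GaloisRepresentations.IdeleLocalInvariants
import HarnessLib

/-!
# The E-side of (R4) as the GLOBAL INVARIANT of an idèle class: `inv_K(Inf_E c ∘ ∂_{C̄}(f ≫ (J̄ → C̄))) = inv E β`,
# `β = iso^J_E ((f^{U_E})_* δ c) ∈ H²(Gal(E/K), J_E)`, with a cocycle representative and a finite support
# (Tate C–F VII §11.2 (bis); Milne ADT I Thm. 4.10, proof)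

Topic `NumberTheory/GaloisRepresentations`; namespace `Literature.NumberTheory.GaloisRepresentations.FreePresentation`.
Theorems only (no definition, no named fact, no instance, no notation, no `sorry`); number fields in `Type`.  Sequel to
door-c4 g17's `IdeleClassBarBoundaryIdeleLayer.lean` (`classBarInv_inflG_comp_boundary_presentation_idele`: the value is
`classInvAll K E ((classRepHom)_* β)`), door-c6 g12's `IdeleClassInvariant.lean` (`IdeleCohomology.classInvAll_ideleToClass`:
`inv_{E/K} ∘ (class map)_* = inv E = Σ_v inv_v`, Tate VII §11.2 (bis)) and door-c5's `IdeleLocalInvariants.lean`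
(`exists_finset_forall_localInv_eq_zero`).

* **`classBarInv_inflG_comp_boundary_presentation_eq_inv`** — `classBarInv K (Inf_E c ∘ ∂(f ≫ g)) = IdeleCohomology.inv E β`
  (the two spellings `(groupCohomology.functor ℤ G 2).map classRepHom` / `groupCohomology.map (MonoidHom.id G) classRepHom 2` of the
  class map agree definitionally).
* **`exists_cocycle_classBarInv_eq_inv`** — the same with `β = [b]` for a `2`-COCYCLE `b` of `Gal(E/K)` in `J_E` (every class has a
  cocycle representative) and a finite set `T` of finite places off which `localInv E v [b] = 0`: items (P1) (E-side value) and (P2)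
  (finite support) of the E-side idèle package of `SchneiderFreeAdditiveX3PoitouTateReciprocityGeneralBase` (door-c4 g18), for EVERY layer
  `E ⊇ K(M)` and EVERY `c ∈ H¹(Γ_K ⧸ U_E, M^{U_E})` — so that the remaining items (P3)/(P4) (the transport of `δ c` to
  `(π_v ∘ f)_* res_v δ₁ x`, door-c6 g18 (L1)) can be stated about the SAME `(E, c, b)`.
* `exists_layer_cocycle_classBarInv_eq_inv` — packaged with `ŷ = Inf_E c` for every `ŷ ∈ Ext¹_{C_Γ}(ℤ, M)`.

HONEST FRAMING: bookkeeping; no arithmetic beyond the cited files, no case of BSD or of Poitou–Tate.  Route A (R4, E-side) of crux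
`AnticycControlAdditiveK` (item 19295, cell bsd-schneider), seat door-c4 gen 18.

## References
* J. W. S. Cassels, A. Fröhlich (eds.), *Algebraic Number Theory* (1967), Ch. VII (J. Tate) §11.2 (bis). [CasselsFrohlichANT1967]
* J. S. Milne, *Arithmetic Duality Theorems* (2nd ed. 2006), I §4, proof of Theorem 4.10 (p. 58). [MilneADT2006]
-/

noncomputable section

open NumberField IsDedekindDomain CategoryTheory CategoryTheory.Abelian groupCohomology
open Field (absoluteGaloisGroup)
open Literature.Algebra.Homology Literature.Algebra.Homology.DiscreteRep
open Literature.NumberTheory.Automorphic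
open scoped Classical

namespace Literature.NumberTheory.GaloisRepresentations

open IdeleClassBar

namespace FreePresentation

variable {K : Type} [Field K] [NumberField K]
variable {M : Type} [AddCommGroup M] [TopologicalSpace M] [DiscreteTopology M] [Finite M] (ρ : DiscreteGaloisModule K M)
-- as in `IdeleClassBarBoundaryIdeleLayer.lean`: the `Ext`-side layer machinery is stated for a profinite `Γ_K` given by instances
-- (discharge with `absoluteGaloisGroup_compactSpace K` / `inferInstance`).
variable [CompactSpace (absoluteGaloisGroup K)] [TotallyDisconnectedSpace (absoluteGaloisGroup K)]

/-- **`classBarInv K (Inf_E c ∘ ∂_{C̄}(f ≫ g)) = inv E β`** with `β = iso^J_E ((f^{U_E})_* (δ_{S^{U_E}} c)) ∈ H²(Gal(E/K), J_E)` and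
`inv E = Σ_v inv_v` door-c5's global invariant of an idèle class (door-c4 g17's idèle-layer formula followed by Tate VII §11.2 (bis)
`inv_{E/K} ∘ (class map)_* = inv E`). [cite: CasselsFrohlichANT1967, Ch. VII §11.2 (bis)][cite: MilneADT2006, I §4, proof of Theorem 4.10] -/
theorem classBarInv_inflG_comp_boundary_presentation_eq_inv {E : GalLayer K} (h : presentationLayer ρ ≤ E)
    (c : groupCohomology ((invariantsQuotFunctor ℤ (E.openNormalSubgroup : Subgroup (absoluteGaloisGroup K))).obj
      (presentationComplex ρ).X₃) 1)
    (f : (presentationComplex ρ).X₁ ⟶ (ideleClassLimitShortComplex K).X₂) :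
    classBarInv K ((LayerColimit.inflG E.openNormalSubgroup (presentationComplex ρ).X₃ 1 c).comp
        (ExtPresentation.boundary (presentationComplex_shortExact ρ) (classBarD K)
          (f ≫ (ideleClassLimitShortComplex K).g)) (rfl : 1 + 1 = 2)) =
      (haveI := E.numberField; haveI := E.isGalois;
        IdeleCohomology.inv E.1
          (((ideleData K).layerCohomologyIso E 2).hom ((groupCohomology.map (MonoidHom.id _)
            ((invariantsQuotFunctor ℤ (E.openNormalSubgroup : Subgroup (absoluteGaloisGroup K))).map f) 2).hom
            ((groupCohomology.δ (presentationComplex_map_invariantsQuotFunctor_shortExact ρ h) 1 2 rfl).hom c)))) := by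
  haveI := E.numberField
  haveI := E.isGalois
  exact (classBarInv_inflG_comp_boundary_presentation_idele ρ h c f).trans (IdeleCohomology.classInvAll_ideleToClass K E.1 _)

set_option maxHeartbeats 800000 in -- the `H2π`/`layerCohomologyIso` unifications are slow (door-c4 g17 FINDING §3)
/-- **The same with a COCYCLE representative and a FINITE SUPPORT**: for every layer `E ⊇ K(M)`, every
`c ∈ H¹(Γ_K ⧸ U_E, M^{U_E})` and every `f : N₁ → J̄` there is a `2`-cocycle `b` of `Gal(E/K)` in `J_E` representing
`β = iso^J_E ((f^{U_E})_* (δ c))`, with `classBarInv K (Inf_E c ∘ ∂(f ≫ g)) = inv E [b]`, and a finite set `T` of finite places of `K`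
off which `localInv E v [b] = 0` — items (P1), (P2) of the E-side idèle package.
[cite: CasselsFrohlichANT1967, Ch. VII §11.2 (bis), §7.3 Prop. 7.3][cite: MilneADT2006, I §4, proof of Theorem 4.10] -/
theorem exists_cocycle_classBarInv_eq_inv {E : GalLayer K} (h : presentationLayer ρ ≤ E)
    (c : groupCohomology ((invariantsQuotFunctor ℤ (E.openNormalSubgroup : Subgroup (absoluteGaloisGroup K))).obj
      (presentationComplex ρ).X₃) 1)
    (f : (presentationComplex ρ).X₁ ⟶ (ideleClassLimitShortComplex K).X₂) :
    ∃ (b : (haveI := E.numberField; cocycles₂ (IdeleClassGroup.ideleRep K E.1))) (T : Finset (HeightOneSpectrum (𝓞 K))),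
      (haveI := E.numberField;
        (H2π (IdeleClassGroup.ideleRep K E.1)) b =
          ((ideleData K).layerCohomologyIso E 2).hom ((groupCohomology.map (MonoidHom.id _)
            ((invariantsQuotFunctor ℤ (E.openNormalSubgroup : Subgroup (absoluteGaloisGroup K))).map f) 2).hom
            ((groupCohomology.δ (presentationComplex_map_invariantsQuotFunctor_shortExact ρ h) 1 2 rfl).hom c))) ∧
      classBarInv K ((LayerColimit.inflG E.openNormalSubgroup (presentationComplex ρ).X₃ 1 c).comp
          (ExtPresentation.boundary (presentationComplex_shortExact ρ) (classBarD K)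
            (f ≫ (ideleClassLimitShortComplex K).g)) (rfl : 1 + 1 = 2)) =
        (haveI := E.numberField; haveI := E.isGalois; IdeleCohomology.inv E.1 ((H2π (IdeleClassGroup.ideleRep K E.1)) b)) ∧
      ∀ v : HeightOneSpectrum (𝓞 K), v ∉ T →
        (haveI := E.numberField; haveI := E.isGalois; IdeleCohomology.localInv E.1 v ((H2π (IdeleClassGroup.ideleRep K E.1)) b)) = 0 := by
  haveI := E.numberField
  haveI := E.isGalois
  have hsurj : ∀ β : groupCohomology (IdeleClassGroup.ideleRep K E.1) 2,
      ∃ b : cocycles₂ (IdeleClassGroup.ideleRep K E.1), (H2π (IdeleClassGroup.ideleRep K E.1)) b = β := fun β =>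
    H2_induction_on (C := fun x => ∃ b : cocycles₂ (IdeleClassGroup.ideleRep K E.1), (H2π (IdeleClassGroup.ideleRep K E.1)) b = x)
      β fun b => ⟨b, rfl⟩
  obtain ⟨b, hb⟩ := hsurj (((ideleData K).layerCohomologyIso E 2).hom ((groupCohomology.map (MonoidHom.id _)
      ((invariantsQuotFunctor ℤ (E.openNormalSubgroup : Subgroup (absoluteGaloisGroup K))).map f) 2).hom
      ((groupCohomology.δ (presentationComplex_map_invariantsQuotFunctor_shortExact ρ h) 1 2 rfl).hom c)))
  obtain ⟨T, hT⟩ := IdeleCohomology.exists_finset_forall_localInv_eq_zero (E := E.1) ((H2π (IdeleClassGroup.ideleRep K E.1)) b)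
  exact ⟨b, T, hb, (classBarInv_inflG_comp_boundary_presentation_eq_inv ρ h c f).trans
    (congrArg (IdeleCohomology.inv E.1) hb.symm), hT⟩

set_option maxHeartbeats 800000 in -- the `H2π`/`layerCohomologyIso` unifications are slow (door-c4 g17 FINDING §3)
/-- **For EVERY `ŷ ∈ Ext¹_{C_Γ}(ℤ, M)` and `f : N₁ → J̄`**: a layer `E ⊇ K(M)`, `c` with `ŷ = Inf_E c`, a `2`-cocycle `b` of `Gal(E/K)` in
`J_E` representing `iso^J_E ((f^{U_E})_* (δ c))`, the identity `classBarInv K (ŷ ∘ ∂(f ≫ g)) = inv E [b]`, and a finite support of the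
finite invariants of `[b]`. [cite: CasselsFrohlichANT1967, Ch. VII §11.2 (bis)][cite: MilneADT2006, I §4, proof of Theorem 4.10] -/
theorem exists_layer_cocycle_classBarInv_eq_inv
    (ŷ : Ext (triv (k := ℤ) (Γ := absoluteGaloisGroup K) ℤ) (presentationComplex ρ).X₃ 1)
    (f : (presentationComplex ρ).X₁ ⟶ (ideleClassLimitShortComplex K).X₂) :
    ∃ (E : GalLayer K) (h : presentationLayer ρ ≤ E) (c : groupCohomology
      ((invariantsQuotFunctor ℤ (E.openNormalSubgroup : Subgroup (absoluteGaloisGroup K))).obj (presentationComplex ρ).X₃) 1)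
      (b : (haveI := E.numberField; cocycles₂ (IdeleClassGroup.ideleRep K E.1))) (T : Finset (HeightOneSpectrum (𝓞 K))),
      LayerColimit.inflG E.openNormalSubgroup (presentationComplex ρ).X₃ 1 c = ŷ ∧
      (haveI := E.numberField;
        (H2π (IdeleClassGroup.ideleRep K E.1)) b =
          ((ideleData K).layerCohomologyIso E 2).hom ((groupCohomology.map (MonoidHom.id _)
            ((invariantsQuotFunctor ℤ (E.openNormalSubgroup : Subgroup (absoluteGaloisGroup K))).map f) 2).hom
            ((groupCohomology.δ (presentationComplex_map_invariantsQuotFunctor_shortExact ρ h) 1 2 rfl).hom c))) ∧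
      classBarInv K (ŷ.comp (ExtPresentation.boundary (presentationComplex_shortExact ρ) (classBarD K)
          (f ≫ (ideleClassLimitShortComplex K).g)) (rfl : 1 + 1 = 2)) =
        (haveI := E.numberField; haveI := E.isGalois; IdeleCohomology.inv E.1 ((H2π (IdeleClassGroup.ideleRep K E.1)) b)) ∧
      ∀ v : HeightOneSpectrum (𝓞 K), v ∉ T →
        (haveI := E.numberField; haveI := E.isGalois; IdeleCohomology.localInv E.1 v ((H2π (IdeleClassGroup.ideleRep K E.1)) b)) = 0 := by
  obtain ⟨E, h, c, rfl⟩ := exists_layer_ge_inflG_eq (presentationLayer ρ) (presentationComplex ρ).X₃ 1 ŷ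
  obtain ⟨b, T, hb, hval, hT⟩ := exists_cocycle_classBarInv_eq_inv ρ h c f
  exact ⟨E, h, c, b, T, rfl, hb, hval, hT⟩

end FreePresentation

end Literature.NumberTheory.GaloisRepresentations

end
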